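import Summits.ValiantsHypothesis.ValiantsHypothesis.Theorems.LacunarySymmetroidMatrixDescartesCensusDoorA34NodePairChart

/-!
# `MatrixDescartes` census — DOOR A at `(3,4)`: the SYLVESTER PENTAHEDRAL CHART of the node determinant (class R4)

HONEST FRAMING.  Object-search cell `pub-symmetroid`, door-A seat `val-sym-door-p3` (g12); item stmt-ValiantsHypothesis-19980
`DoorA34 = PosRootLawAt 3 4 18` (route item `Theses.LacunarySymmetroid.DoorA34`) is OPEN and asserted nowhere in this file.
Nothing here bounds `ζ_sym(3,4)`; nothing bears on `MatrixDescartes` (stmt-ValiantsHypothesis-18050) or on `VP ≠ VNP`.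

CONTENT (ring identities, [folklore]: Sylvester's pentahedral form of a cubic surface, specialised to Cayley's 4-nodal
cubic `e₃`).  With the LINEAR chart `Mᵢ := e₁(m) − 2 mᵢ` (`e₁(m) = m₀ + m₁ + m₂ + m₃`; inverse `mᵢ = ((∑ M)/2 − Mᵢ)/2`,
`pentaChart_inverse`):

* `e3_pentaChart` — `96 · e₃(m) = (M₀ + M₁ + M₂ + M₃)³ − 4 · (M₀³ + M₁³ + M₂³ + M₃³)` (any commutative ring).
  Equivalently, with the FIVE forms `L₀..L₃ := M₀..M₃`, `L₄ := −(M₀ + M₁ + M₂ + M₃)` (so `∑ₖ Lₖ = 0`, a pentahedron):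
  `−96 · e₃(m) = 4 L₀³ + 4 L₁³ + 4 L₂³ + 4 L₃³ + L₄³` (`e3_pentahedral_weights`) — Cayley's cubic is the pentahedral cubic
  `∑ₖ λₖ Lₖ³` with WEIGHTS `λ = (4,4,4,4,1)`; in Sylvester's singularity test `∑ₖ ±λₖ^{-1/2} = 0`, `λ^{-1/2} = (½,½,½,½,1)`
  admits exactly the four relations `½+½+½−½−1 = 0` — the four nodes `M = (1,1,1,−1)` & permutations
  (`pentaChart_gradient_at_node`: all four partials `3(∑M)² − 12 Mᵢ²` vanish there, and so does the cubic).
* `det_sum_four_rankOne_pentaChart` — combined with `det_sum_four_rankOne_eq_e3` (…NodePairChart): for a four-real-node net,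
  `96 W² · det (∑ᵢ ℓᵢ • vᵢvᵢᵀ) = (∑ᵢ Mᵢ)³ − 4 ∑ᵢ Mᵢ³` with `W = ∏ Cᵢ²`, `mᵢ = ℓᵢ ∏_{j≠i} Cⱼ²`, `Mᵢ = e₁(m) − 2mᵢ`.

READING (paper, same status as the `e₃` / pair charts of this directory: generic nets + openness of the 19-root locus):
along a class-R4 pencil the node nomials `ℓᵢ(t)`, hence the `Mᵢ(t)`, range over the bases of the 4-nomial space
`V_d = span{t^{d_l}}`; so  **DoorA34 (class R4) ⟺ Z₊( (M₀+M₁+M₂+M₃)³ − 4(M₀³+M₁³+M₂³+M₃³) ) ≤ 18 for every basis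
(M₀,…,M₃) of V_d and every 3-Sidon d**, whereas a GENERAL real cubic surface is `∑ₖ λₖ Lₖ³` with FREE weights λ and reaches
19 (`Census.G3K4E1`).  The door is thus a statement about ONE weight vector `(4,4,4,4,1)` (up to `S₅`) in Sylvester's
4-simplex of weights; the 1-nodal real cubics with a solitary point are `(16,16,16,16,1)` (`λ^{-1/2} = (¼,¼,¼,¼,1)`, one
relation), and the weights strictly between, `(c,c,c,c,1)` with `4 < c < 16`, are the smooth two-component (hyperbolic) cubics
of the same pentahedron.  Located (this seat, exact-sign screen, 2026-08-27): 19-root cubics that are hyperbolic w.r.t. a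
direction exist numerically on `d = (0,2,5,34)` (3 150 / 3 150 sampled lines real-rooted) — so «hyperbolic ⇒ ≤ 18»
(the H′ of report DOOR-A34-P3G11 §2(e)) is NOT a usable strengthening; the door, if true, is local to the Cayley weights.
-/

-- `Summit.ValiantsHypothesis.ValiantsHypothesis.…` repeats a component by the D-0017 layout
-- (single-conjunct summit), which the `dupNamespace` linter flags; the name is mandated.
set_option linter.dupNamespace false

namespace Summit.ValiantsHypothesis.ValiantsHypothesis.Theorems.LacunarySymmetroidMatrixDescartes.Census

open Finset
open scoped BigOperators Matrix

/-- **Sylvester pentahedral chart of Cayley's cubic** (any commutative ring): with `Mᵢ = (m₀+m₁+m₂+m₃) − 2mᵢ`,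
`96 · e₃(m) = (∑ M)³ − 4 ∑ M³`. [folklore] -/
theorem e3_pentaChart {R : Type*} [CommRing R] (m₀ m₁ m₂ m₃ : R) :
    96 * (m₁ * m₂ * m₃ + m₀ * m₂ * m₃ + m₀ * m₁ * m₃ + m₀ * m₁ * m₂) =
      ((m₀ + m₁ + m₂ + m₃ - 2 * m₀) + (m₀ + m₁ + m₂ + m₃ - 2 * m₁) + (m₀ + m₁ + m₂ + m₃ - 2 * m₂)
          + (m₀ + m₁ + m₂ + m₃ - 2 * m₃)) ^ 3
        - 4 * ((m₀ + m₁ + m₂ + m₃ - 2 * m₀) ^ 3 + (m₀ + m₁ + m₂ + m₃ - 2 * m₁) ^ 3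
          + (m₀ + m₁ + m₂ + m₃ - 2 * m₂) ^ 3 + (m₀ + m₁ + m₂ + m₃ - 2 * m₃) ^ 3) := by
  ring

/-- The same identity with the pentahedral forms named: `M₀..M₃` arbitrary, `mᵢ` recovered by the inverse chart
`4 mᵢ = (M₀+M₁+M₂+M₃) − 2 Mᵢ`; then `96 · 4³ · e₃(m) = 4³ · ((∑M)³ − 4∑M³)`, i.e. (division-free form)
`96 · e₃(4m) = 64 · ((∑ M)³ − 4 ∑ M³)`. [folklore] -/
theorem e3_pentaChart' {R : Type*} [CommRing R] (M₀ M₁ M₂ M₃ : R) :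
    96 * (((M₀ + M₁ + M₂ + M₃) - 2 * M₁) * ((M₀ + M₁ + M₂ + M₃) - 2 * M₂) * ((M₀ + M₁ + M₂ + M₃) - 2 * M₃)
        + ((M₀ + M₁ + M₂ + M₃) - 2 * M₀) * ((M₀ + M₁ + M₂ + M₃) - 2 * M₂) * ((M₀ + M₁ + M₂ + M₃) - 2 * M₃)
        + ((M₀ + M₁ + M₂ + M₃) - 2 * M₀) * ((M₀ + M₁ + M₂ + M₃) - 2 * M₁) * ((M₀ + M₁ + M₂ + M₃) - 2 * M₃)
        + ((M₀ + M₁ + M₂ + M₃) - 2 * M₀) * ((M₀ + M₁ + M₂ + M₃) - 2 * M₁) * ((M₀ + M₁ + M₂ + M₃) - 2 * M₂)) =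
      64 * ((M₀ + M₁ + M₂ + M₃) ^ 3 - 4 * (M₀ ^ 3 + M₁ ^ 3 + M₂ ^ 3 + M₃ ^ 3)) := by
  ring

/-- **Inverse chart**: `Mᵢ = e₁(m) − 2mᵢ` is inverted by `mᵢ = ((∑ M)/2 − Mᵢ)/2` (here division-free:
`4 mᵢ = (∑ⱼ Mⱼ) − 2 Mᵢ`). [folklore] -/
theorem pentaChart_inverse {R : Type*} [CommRing R] (m₀ m₁ m₂ m₃ : R) :
    4 * m₀ = ((m₀ + m₁ + m₂ + m₃ - 2 * m₀) + (m₀ + m₁ + m₂ + m₃ - 2 * m₁) + (m₀ + m₁ + m₂ + m₃ - 2 * m₂)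
        + (m₀ + m₁ + m₂ + m₃ - 2 * m₃)) - 2 * (m₀ + m₁ + m₂ + m₃ - 2 * m₀) := by
  ring

/-- **Cayley's cubic as a pentahedral cubic with weights `(4,4,4,4,1)`**: with `L₀..L₃ = M₀..M₃` and
`L₄ = −(M₀+M₁+M₂+M₃)` (so `L₀+L₁+L₂+L₃+L₄ = 0`), `(∑M)³ − 4∑M³ = −(4L₀³ + 4L₁³ + 4L₂³ + 4L₃³ + L₄³)`. [folklore] -/
theorem e3_pentahedral_weights {R : Type*} [CommRing R] (M₀ M₁ M₂ M₃ L₄ : R) (hL : M₀ + M₁ + M₂ + M₃ + L₄ = 0) :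
    (M₀ + M₁ + M₂ + M₃) ^ 3 - 4 * (M₀ ^ 3 + M₁ ^ 3 + M₂ ^ 3 + M₃ ^ 3) =
      -(4 * M₀ ^ 3 + 4 * M₁ ^ 3 + 4 * M₂ ^ 3 + 4 * M₃ ^ 3 + L₄ ^ 3) := by
  have h : L₄ = -(M₀ + M₁ + M₂ + M₃) := by linear_combination hL
  subst h
  ring

/-- **The four nodes in the pentahedral chart**: at `M = (s,s,s,−s)` (and its permutations) the cubic
`P(M) = (∑M)³ − 4∑M³` vanishes together with all four partials `∂P/∂Mᵢ = 3(∑M)² − 12Mᵢ²`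
(Sylvester's relation `½+½+½−½ = 1` among `λ^{-1/2} = (½,½,½,½,1)`). [folklore] -/
theorem pentaChart_node {R : Type*} [CommRing R] (s : R) :
    (s + s + s + -s) ^ 3 - 4 * (s ^ 3 + s ^ 3 + s ^ 3 + (-s) ^ 3) = 0 ∧
      3 * (s + s + s + -s) ^ 2 - 12 * s ^ 2 = 0 ∧ 3 * (s + s + s + -s) ^ 2 - 12 * (-s) ^ 2 = 0 := by
  refine ⟨by ring, by ring, by ring⟩

/-- **The solitary point of the weight family**: for the neighbouring weights `(16,16,16,16,1)`, i.e. the cubic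
`Q(M) = (∑M)³ − 16∑M³`, the point `M = (s,s,s,s)` is singular (`Q = 0` and `∂Q/∂Mᵢ = 3(∑M)² − 48Mᵢ² = 0`):
Sylvester's single relation `¼+¼+¼+¼ = 1`. [folklore] -/
theorem pentaChart_solitary_node {R : Type*} [CommRing R] (s : R) :
    (s + s + s + s) ^ 3 - 16 * (s ^ 3 + s ^ 3 + s ^ 3 + s ^ 3) = 0 ∧ 3 * (s + s + s + s) ^ 2 - 48 * s ^ 2 = 0 := by
  refine ⟨by ring, by ring⟩

/-- **Pentahedral chart of a four-real-node determinant**: with the cofactors `Cᵢ` of `det_sum_four_rankOne`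
(hypotheses `hC0..hC3`), weighted node values `mᵢ = ℓᵢ ∏_{j≠i} Cⱼ²` and `Mᵢ = (m₀+m₁+m₂+m₃) − 2mᵢ`:
`96 · (C₀²C₁²C₂²C₃²)² · det (∑ᵢ ℓᵢ • vᵢvᵢᵀ) = (M₀+M₁+M₂+M₃)³ − 4 (M₀³+M₁³+M₂³+M₃³)`. [folklore] -/
theorem det_sum_four_rankOne_pentaChart (v : Fin 4 → Fin 3 → ℝ) (ℓ : Fin 4 → ℝ) (C0 C1 C2 C3 m0 m1 m2 m3 M0 M1 M2 M3 : ℝ)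
    (hC0 : C0 = v 1 0 * (v 2 1 * v 3 2 - v 3 1 * v 2 2) - v 2 0 * (v 1 1 * v 3 2 - v 3 1 * v 1 2)
          + v 3 0 * (v 1 1 * v 2 2 - v 2 1 * v 1 2))
    (hC1 : C1 = v 0 0 * (v 2 1 * v 3 2 - v 3 1 * v 2 2) - v 2 0 * (v 0 1 * v 3 2 - v 3 1 * v 0 2)
          + v 3 0 * (v 0 1 * v 2 2 - v 2 1 * v 0 2))
    (hC2 : C2 = v 0 0 * (v 1 1 * v 3 2 - v 3 1 * v 1 2) - v 1 0 * (v 0 1 * v 3 2 - v 3 1 * v 0 2)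
          + v 3 0 * (v 0 1 * v 1 2 - v 1 1 * v 0 2))
    (hC3 : C3 = v 0 0 * (v 1 1 * v 2 2 - v 2 1 * v 1 2) - v 1 0 * (v 0 1 * v 2 2 - v 2 1 * v 0 2)
          + v 2 0 * (v 0 1 * v 1 2 - v 1 1 * v 0 2))
    (hm0 : m0 = ℓ 0 * (C1 ^ 2 * C2 ^ 2 * C3 ^ 2)) (hm1 : m1 = ℓ 1 * (C0 ^ 2 * C2 ^ 2 * C3 ^ 2))
    (hm2 : m2 = ℓ 2 * (C0 ^ 2 * C1 ^ 2 * C3 ^ 2)) (hm3 : m3 = ℓ 3 * (C0 ^ 2 * C1 ^ 2 * C2 ^ 2))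
    (hM0 : M0 = (m0 + m1 + m2 + m3) - 2 * m0) (hM1 : M1 = (m0 + m1 + m2 + m3) - 2 * m1)
    (hM2 : M2 = (m0 + m1 + m2 + m3) - 2 * m2) (hM3 : M3 = (m0 + m1 + m2 + m3) - 2 * m3) :
    96 * (C0 ^ 2 * C1 ^ 2 * C2 ^ 2 * C3 ^ 2) ^ 2 * (∑ i, ℓ i • Matrix.vecMulVec (v i) (v i)).det
      = (M0 + M1 + M2 + M3) ^ 3 - 4 * (M0 ^ 3 + M1 ^ 3 + M2 ^ 3 + M3 ^ 3) := by
  have h := det_sum_four_rankOne_eq_e3 v ℓ C0 C1 C2 C3 hC0 hC1 hC2 hC3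
  have h96 : 96 * (C0 ^ 2 * C1 ^ 2 * C2 ^ 2 * C3 ^ 2) ^ 2 * (∑ i, ℓ i • Matrix.vecMulVec (v i) (v i)).det
      = 96 * (m1 * m2 * m3 + m0 * m2 * m3 + m0 * m1 * m3 + m0 * m1 * m2) := by
    rw [hm0, hm1, hm2, hm3, mul_assoc, h]
  rw [h96, e3_pentaChart, hM0, hM1, hM2, hM3]

end Summit.ValiantsHypothesis.ValiantsHypothesis.Theorems.LacunarySymmetroidMatrixDescartes.Census
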